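import Summits.QuantumFields.YangMills.Theorems.UnitScaleTiltProp7KernelRowColumnGauge
import HarnessLib

/-!
# Route `UnitScaleTilt`, crux K1 «MinimiserStabilityRegPr» (stmt-QuantumFields-19200), EX face — ONE-FORM ∕ K137 STOREYS, FILE (K1-alg, part 2 of 2):
# **COMPOSITION, POWERS AND THE NEUMANN INVERSE OF DISPLAYED KERNEL ROWS** — ROW(B₁; C₁, μ₁)·ROW(B₂; C₂, μ₂) ⇒ ROW(B₁B₂; C₁C₂·V·S, r); ROW(B^k); and for
# `C·V·S < 1` EVERY inverse `U` of `1 − B` carries ROW(U; 1∕(1 − C·V·S), r) — the row algebra of the p.421 perturbation series, with the `ℓ⁻³` shape preserved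

Cell `ym3-torus` (HUMAN RULING D-0037; rung R3 = SU(2) YM₃ on T³ — NOT d = 4, NOT infinite volume, NOT a mass gap, NOT Clay).  Width seat px10 g12 (FREE px; ★`ym-ust-19200-p1`
g26 CHAIR WORD №14 «`…KernelRowComposition` — row algebra: comp∕id∕pow∕finite Neumann for the p.421 perturbation series around G₀»).  THEOREMS ONLY (0 `def`, 0 `sorry`,
default heartbeats); `--supports stmt-QuantumFields-19200 --as helper`; count-neutral.  Part 1 = ✓`…Prop7KernelRowColumnGauge` (the texts ROW ∕ COLW, the cone, the gauge).

THE TEXTS (inline, never defined; as in part 1).  ROW(B; C, μ′) := `∀ b Z b_d, ‖toL2⁻¹(B(toL2 (δ_b Z)))(b_d)‖ ≤ C·e^{−μ′·dc(b, b_d)}·‖Z‖` (O4e's `hk`);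
COLW(B; N, r) := `∀ b Z, Σ_{b_d} ‖toL2⁻¹(B(toL2 (δ_b Z)))(b_d)‖·e^{+r·dc(b, b_d)} ≤ N·‖Z‖`; `V := d·(L^d)^{K−n}`, `S_ν := (2(1+1∕ν))³`.
THE ARGUMENT.  §1: COLW(B^k; N^k) by induction over part 1's ★`colw_mul`; finite Neumann sums by `geom_sum_mul_neg`.  §2: the composition row DIRECTLY (pointwise): expand the
middle vector in bond spikes, bound both factors by their rows, trade `e^{−μ₂ dc(b, b′)} ≤ e^{−r dc(b, b′)}` and the triangle inequality for `e^{−r dc(b, b_d)}`, and sum the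
remaining `e^{−(μ₁−r) dc(b′, b_d)}` blockwise (`V·S_{μ₁−r}`); powers through the gauge (ROW ⇒ COLW ⇒ COLW^k ⇒ ROW).  §3: THE NEUMANN ROW WITHOUT A SERIES — if COLW(B; N, r) with
`N < 1` and `(1 − B)·U = 1`, then `U = 1 + B·U`, so for each spike the finite weighted sum `S_U` obeys `S_U ≤ ‖Z‖ + N·S_U` (part 1's ★`colw_apply_le`), i.e. COLW(U; 1∕(1−N), r);
`1 − B` IS invertible (`x = Bx` ⇒ `S_x ≤ N·S_x` ⇒ `x = 0`; injective ⇒ bijective on the finite-dimensional `BondL2K`, through `toL2`), and a right inverse is a left inverse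
(`mul_eq_one_comm`).  AT THE PINS `Cᵢ = cᵢ·ℓ⁻³`, `V = 3ℓ³`: `C₁C₂·V·S = 3c₁c₂S·ℓ⁻³` — the `ℓ⁻³` SHAPE IS PRESERVED; the Neumann smallness `C·V·S = 3cS < 1` is K-FREE.
WHAT IS PROVED (ns `Summit.QuantumFields.YangMills.Theorems.Prop7KernelRowComposition`).
* §1 ★`colw_pow`, ★`colw_geom_sum`.
* §2 ★★`kernelRow_mul` (and `kernelRow_comp`, the `∘ₗ` spelling), ★★`kernelRow_pow`, `kernelRow_geom_sum`.
* §3 ★★★`colw_of_mul_eq_one` (left inverse), `injective_one_sub_of_colw`, ★`exists_inverse_one_sub_of_colw`, `colw_of_mul_eq_one'` (right inverse),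
  ★★★`kernelRow_inverse_of_kernelRow` (ROW(B; C, μ′), `0 ≤ r < μ′`, `C·V·S_{μ′−r} < 1`, `(1 − B)·U = 1` ⇒ ROW(U; 1∕(1 − C·V·S_{μ′−r}), r)), ★`exists_inverse_kernelRow`.
HONEST SCOPE.  Row algebra ∕ bookkeeping over displayed letters; no estimate of print is proved; nothing of `hk_G₀` (K2), the γ-row, the K137 storey, the ten EX rows, EX or the
crux is proved here; the Yang–Mills mass gap is NOT proved.

References: T. Bałaban, CMP **99** (1985) 389–434 [Balaban1985BackgroundPropagators] ((3.46)–(3.49) pp.398–399, (3.86) p.409, (3.131)–(3.134) pp.421–422);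
CMP **96** (1984) 223–250 [Balaban1984PropagatorsII] (§2, random-walk ∕ Neumann expansions of kernels with exponential decay).
-/

set_option autoImplicit false

noncomputable section

open scoped BigOperators Matrix.Norms.L2Operator InnerProductSpace ComplexConjugate

namespace Summit.QuantumFields.YangMills.Theorems.Prop7KernelRowComposition

open Literature.MathematicalPhysics.QuantumFieldTheory.Balaban1983to89
open Literature.MathematicalPhysics.QuantumFieldTheory.Balaban1983to89.T3ContinuumYM3Torus
open B11Eq103H1Complex (BondL2K)
open B5Eq118OneStroke (iterBlockOf)
open Summit.QuantumFields.YangMills.Theorems.Prop7SectET3Transport (periodsT3)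
open Summit.QuantumFields.YangMills.Theorems.Prop7SectET3HilbertLetters (W₂ toL2)
open Summit.QuantumFields.YangMills.Theorems.Prop7BlockDistanceWeights (sum_exp_neg_mul_tdist_coarse_le tdist_coarse_comm tdist_coarse_triangle)
open Summit.QuantumFields.YangMills.Theorems.Prop7KernelRowColumnGauge (symm_apply_eq_sum_single sum_pbond_blockwise exp_tdist_coarse_triangle tdist_coarse_self
  kernelRow_mono kernelRow_one colw_of_kernelRow kernelRow_of_colw colw_apply_le colw_mul colw_one colw_sum)

variable (F : T3Family) {n K : ℕ} {c₀ : ℝ}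

/-! ## §1 Powers and finite Neumann sums in the gauge -/

/-- ★ **COLW OF POWERS**: COLW(B; N, r), `0 ≤ r`, `0 ≤ N` ⇒ COLW(B^k; N^k, r) for every `k`. [cite: Balaban1984PropagatorsII, §2] -/
theorem colw_pow (B : BondL2K ℂ 3 (periodsT3 F K) c₀ W₂ →ₗ[ℂ] BondL2K ℂ 3 (periodsT3 F K) c₀ W₂) {N r : ℝ} (hr : 0 ≤ r) (hN : 0 ≤ N)
    (hcol : ∀ (b : PBond (F.P K) 0) (Z : Matrix (Fin 2) (Fin 2) ℂ),
      ∑ bd : PBond (F.P K) 0, ‖(toL2 F K c₀).symm (B (toL2 F K c₀ (Pi.single b Z))) bd‖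
          * Real.exp (r * (Site.tdist (P := F.P K) (iterBlockOf (K - n) b.src) (iterBlockOf (K - n) bd.src) : ℝ)) ≤ N * ‖Z‖) :
    ∀ (k : ℕ) (b : PBond (F.P K) 0) (Z : Matrix (Fin 2) (Fin 2) ℂ),
    ∑ bd : PBond (F.P K) 0, ‖(toL2 F K c₀).symm ((B ^ k) (toL2 F K c₀ (Pi.single b Z))) bd‖
        * Real.exp (r * (Site.tdist (P := F.P K) (iterBlockOf (K - n) b.src) (iterBlockOf (K - n) bd.src) : ℝ)) ≤ N ^ k * ‖Z‖ := by
  intro k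
  induction k with
  | zero => intro b Z; rw [pow_zero, pow_zero]; exact colw_one F r b Z
  | succ k ih => intro b Z; rw [pow_succ, pow_succ]; exact colw_mul F (B ^ k) B hr (pow_nonneg hN k) ih hcol b Z

/-- ★ **FINITE NEUMANN SUMS**: COLW(B; N, r), `0 ≤ r`, `0 ≤ N < 1` ⇒ COLW(Σ_{k<m} B^k; 1∕(1−N), r) for every `m`. [cite: Balaban1984PropagatorsII, §2] -/
theorem colw_geom_sum (B : BondL2K ℂ 3 (periodsT3 F K) c₀ W₂ →ₗ[ℂ] BondL2K ℂ 3 (periodsT3 F K) c₀ W₂) {N r : ℝ} (hr : 0 ≤ r) (hN : 0 ≤ N) (hN1 : N < 1)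
    (hcol : ∀ (b : PBond (F.P K) 0) (Z : Matrix (Fin 2) (Fin 2) ℂ),
      ∑ bd : PBond (F.P K) 0, ‖(toL2 F K c₀).symm (B (toL2 F K c₀ (Pi.single b Z))) bd‖
          * Real.exp (r * (Site.tdist (P := F.P K) (iterBlockOf (K - n) b.src) (iterBlockOf (K - n) bd.src) : ℝ)) ≤ N * ‖Z‖)
    (m : ℕ) (b : PBond (F.P K) 0) (Z : Matrix (Fin 2) (Fin 2) ℂ) :
    ∑ bd : PBond (F.P K) 0, ‖(toL2 F K c₀).symm ((∑ k ∈ Finset.range m, B ^ k) (toL2 F K c₀ (Pi.single b Z))) bd‖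
        * Real.exp (r * (Site.tdist (P := F.P K) (iterBlockOf (K - n) b.src) (iterBlockOf (K - n) bd.src) : ℝ)) ≤ (1 / (1 - N)) * ‖Z‖ := by
  have hgeom : ∑ k ∈ Finset.range m, N ^ k ≤ 1 / (1 - N) := by
    rw [le_div_iff₀ (by linarith), geom_sum_mul_neg]
    linarith [pow_nonneg hN m]
  exact (colw_sum F (Finset.range m) (fun k => B ^ k) (fun k => N ^ k) (fun k _ => colw_pow F B hr hN hcol k) b Z).trans
    (mul_le_mul_of_nonneg_right hgeom (norm_nonneg _))


/-! ## §2 The composition row and powers in ROW currency -/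

/-- ★★ **THE COMPOSITION ROW**: ROW(B₁; C₁, μ₁), ROW(B₂; C₂, μ₂), `0 ≤ r < μ₁`, `r ≤ μ₂` ⇒ ROW(B₁·B₂; C₁·C₂·V·S_{μ₁−r}, r), `V = d·(L^d)^{K−n}`, `S_ν = (2(1+1∕ν))³`.
At the pins `Cᵢ = cᵢℓ⁻³`, `V = 3ℓ³`: constant `3c₁c₂S·ℓ⁻³` — the `ℓ⁻³` shape is preserved. [cite: Balaban1985BackgroundPropagators, (3.49) p.399; Balaban1984PropagatorsII, §2] -/
theorem kernelRow_mul (B₁ B₂ : BondL2K ℂ 3 (periodsT3 F K) c₀ W₂ →ₗ[ℂ] BondL2K ℂ 3 (periodsT3 F K) c₀ W₂) {C₁ C₂ μ₁ μ₂ r : ℝ}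
    (hC₁ : 0 ≤ C₁) (hC₂ : 0 ≤ C₂) (hr : 0 ≤ r) (hr₁ : r < μ₁) (hr₂ : r ≤ μ₂)
    (h₁ : ∀ (b : PBond (F.P K) 0) (Z : Matrix (Fin 2) (Fin 2) ℂ) (bd : PBond (F.P K) 0),
      ‖(toL2 F K c₀).symm (B₁ (toL2 F K c₀ (Pi.single b Z))) bd‖
        ≤ C₁ * Real.exp (-(μ₁ * (Site.tdist (P := F.P K) (iterBlockOf (K - n) b.src) (iterBlockOf (K - n) bd.src) : ℝ))) * ‖Z‖)
    (h₂ : ∀ (b : PBond (F.P K) 0) (Z : Matrix (Fin 2) (Fin 2) ℂ) (bd : PBond (F.P K) 0),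
      ‖(toL2 F K c₀).symm (B₂ (toL2 F K c₀ (Pi.single b Z))) bd‖
        ≤ C₂ * Real.exp (-(μ₂ * (Site.tdist (P := F.P K) (iterBlockOf (K - n) b.src) (iterBlockOf (K - n) bd.src) : ℝ))) * ‖Z‖)
    (b : PBond (F.P K) 0) (Z : Matrix (Fin 2) (Fin 2) ℂ) (bd : PBond (F.P K) 0) :
    ‖(toL2 F K c₀).symm ((B₁ * B₂) (toL2 F K c₀ (Pi.single b Z))) bd‖
      ≤ C₁ * C₂ * (((F.P K).d : ℝ) * ((((F.P K).L : ℝ) ^ (F.P K).d) ^ (K - n))) * (2 * (1 + 1 / (μ₁ - r))) ^ 3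
          * Real.exp (-(r * (Site.tdist (P := F.P K) (iterBlockOf (K - n) b.src) (iterBlockOf (K - n) bd.src) : ℝ))) * ‖Z‖ := by
  classical
  have happ : (B₁ * B₂) (toL2 F K c₀ (Pi.single b Z))
      = B₁ (toL2 F K c₀ ((toL2 F K c₀).symm (B₂ (toL2 F K c₀ (Pi.single b Z))))) := by
    rw [Module.End.mul_apply, LinearEquiv.apply_symm_apply]
  rw [happ, symm_apply_eq_sum_single F B₁ _ bd]
  -- termwise two-row bound with the rate trade
  have h3 : ∀ b' : PBond (F.P K) 0,
      ‖(toL2 F K c₀).symm (B₁ (toL2 F K c₀ (Pi.single b' ((toL2 F K c₀).symm (B₂ (toL2 F K c₀ (Pi.single b Z))) b')))) bd‖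
        ≤ C₁ * C₂ * ‖Z‖ * Real.exp (-(r * (Site.tdist (P := F.P K) (iterBlockOf (K - n) b.src) (iterBlockOf (K - n) bd.src) : ℝ)))
            * Real.exp (-((μ₁ - r) * (Site.tdist (P := F.P K) (iterBlockOf (K - n) b'.src) (iterBlockOf (K - n) bd.src) : ℝ))) := by
    intro b'
    have hd₁ : (0:ℝ) ≤ (Site.tdist (P := F.P K) (iterBlockOf (K - n) b'.src) (iterBlockOf (K - n) bd.src) : ℝ) := Nat.cast_nonneg _
    have hd₂ : (0:ℝ) ≤ (Site.tdist (P := F.P K) (iterBlockOf (K - n) b.src) (iterBlockOf (K - n) b'.src) : ℝ) := Nat.cast_nonneg _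
    have htri := tdist_coarse_triangle F (iterBlockOf (K - n) b.src) (iterBlockOf (K - n) b'.src) (iterBlockOf (K - n) bd.src)
    have hexp2 : Real.exp (-(μ₁ * (Site.tdist (P := F.P K) (iterBlockOf (K - n) b'.src) (iterBlockOf (K - n) bd.src) : ℝ))) * Real.exp (-(μ₂ * (Site.tdist (P := F.P K) (iterBlockOf (K - n) b.src) (iterBlockOf (K - n) b'.src) : ℝ)))
        ≤ Real.exp (-(r * (Site.tdist (P := F.P K) (iterBlockOf (K - n) b.src) (iterBlockOf (K - n) bd.src) : ℝ))) * Real.exp (-((μ₁ - r) * (Site.tdist (P := F.P K) (iterBlockOf (K - n) b'.src) (iterBlockOf (K - n) bd.src) : ℝ))) := by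
      rw [← Real.exp_add, ← Real.exp_add, Real.exp_le_exp]
      nlinarith [mul_le_mul_of_nonneg_left htri hr, mul_le_mul_of_nonneg_right hr₂ hd₂]
    refine (h₁ b' _ bd).trans ?_
    calc C₁ * Real.exp (-(μ₁ * (Site.tdist (P := F.P K) (iterBlockOf (K - n) b'.src) (iterBlockOf (K - n) bd.src) : ℝ))) * ‖(toL2 F K c₀).symm (B₂ (toL2 F K c₀ (Pi.single b Z))) b'‖
        ≤ C₁ * Real.exp (-(μ₁ * (Site.tdist (P := F.P K) (iterBlockOf (K - n) b'.src) (iterBlockOf (K - n) bd.src) : ℝ))) * (C₂ * Real.exp (-(μ₂ * (Site.tdist (P := F.P K) (iterBlockOf (K - n) b.src) (iterBlockOf (K - n) b'.src) : ℝ))) * ‖Z‖) :=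
          mul_le_mul_of_nonneg_left (h₂ b Z b') (by positivity)
      _ = C₁ * C₂ * ‖Z‖ * (Real.exp (-(μ₁ * (Site.tdist (P := F.P K) (iterBlockOf (K - n) b'.src) (iterBlockOf (K - n) bd.src) : ℝ))) * Real.exp (-(μ₂ * (Site.tdist (P := F.P K) (iterBlockOf (K - n) b.src) (iterBlockOf (K - n) b'.src) : ℝ)))) := by ring
      _ ≤ C₁ * C₂ * ‖Z‖ * (Real.exp (-(r * (Site.tdist (P := F.P K) (iterBlockOf (K - n) b.src) (iterBlockOf (K - n) bd.src) : ℝ))) * Real.exp (-((μ₁ - r) * (Site.tdist (P := F.P K) (iterBlockOf (K - n) b'.src) (iterBlockOf (K - n) bd.src) : ℝ)))) :=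
          mul_le_mul_of_nonneg_left hexp2 (by positivity)
      _ = _ := by ring
  -- the blockwise K-free volume
  have hν : 0 < μ₁ - r := by linarith
  have h4 : ∑ b' : PBond (F.P K) 0, Real.exp (-((μ₁ - r) * (Site.tdist (P := F.P K) (iterBlockOf (K - n) b'.src) (iterBlockOf (K - n) bd.src) : ℝ)))
      ≤ (((F.P K).d : ℝ) * ((((F.P K).L : ℝ) ^ (F.P K).d) ^ (K - n))) * (2 * (1 + 1 / (μ₁ - r))) ^ 3 := by
    rw [sum_pbond_blockwise F (fun y => Real.exp (-((μ₁ - r) * (Site.tdist (P := F.P K) y (iterBlockOf (K - n) bd.src) : ℝ))))]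
    exact mul_le_mul_of_nonneg_left (sum_exp_neg_mul_tdist_coarse_le F (n := n) (K := K) hν _) (by positivity)
  calc ‖∑ b' : PBond (F.P K) 0, (toL2 F K c₀).symm (B₁ (toL2 F K c₀ (Pi.single b' ((toL2 F K c₀).symm (B₂ (toL2 F K c₀ (Pi.single b Z))) b')))) bd‖
      ≤ ∑ b' : PBond (F.P K) 0, ‖(toL2 F K c₀).symm (B₁ (toL2 F K c₀ (Pi.single b' ((toL2 F K c₀).symm (B₂ (toL2 F K c₀ (Pi.single b Z))) b')))) bd‖ :=
        norm_sum_le _ _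
    _ ≤ ∑ b' : PBond (F.P K) 0, C₁ * C₂ * ‖Z‖ * Real.exp (-(r * (Site.tdist (P := F.P K) (iterBlockOf (K - n) b.src) (iterBlockOf (K - n) bd.src) : ℝ)))
            * Real.exp (-((μ₁ - r) * (Site.tdist (P := F.P K) (iterBlockOf (K - n) b'.src) (iterBlockOf (K - n) bd.src) : ℝ))) := Finset.sum_le_sum fun b' _ => h3 b'
    _ = C₁ * C₂ * ‖Z‖ * Real.exp (-(r * (Site.tdist (P := F.P K) (iterBlockOf (K - n) b.src) (iterBlockOf (K - n) bd.src) : ℝ)))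
            * ∑ b' : PBond (F.P K) 0, Real.exp (-((μ₁ - r) * (Site.tdist (P := F.P K) (iterBlockOf (K - n) b'.src) (iterBlockOf (K - n) bd.src) : ℝ))) := by rw [Finset.mul_sum]
    _ ≤ C₁ * C₂ * ‖Z‖ * Real.exp (-(r * (Site.tdist (P := F.P K) (iterBlockOf (K - n) b.src) (iterBlockOf (K - n) bd.src) : ℝ))) * ((((F.P K).d : ℝ) * ((((F.P K).L : ℝ) ^ (F.P K).d) ^ (K - n))) * (2 * (1 + 1 / (μ₁ - r))) ^ 3) :=
        mul_le_mul_of_nonneg_left h4 (by positivity)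
    _ = _ := by ring

/-- The composition row in the `∘ₗ` spelling (`B₁ ∘ₗ B₂ = B₁ * B₂` in `Module.End`). [cite: Balaban1985BackgroundPropagators, (3.49) p.399] -/
theorem kernelRow_comp (B₁ B₂ : BondL2K ℂ 3 (periodsT3 F K) c₀ W₂ →ₗ[ℂ] BondL2K ℂ 3 (periodsT3 F K) c₀ W₂) {C₁ C₂ μ₁ μ₂ r : ℝ}
    (hC₁ : 0 ≤ C₁) (hC₂ : 0 ≤ C₂) (hr : 0 ≤ r) (hr₁ : r < μ₁) (hr₂ : r ≤ μ₂)
    (h₁ : ∀ (b : PBond (F.P K) 0) (Z : Matrix (Fin 2) (Fin 2) ℂ) (bd : PBond (F.P K) 0),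
      ‖(toL2 F K c₀).symm (B₁ (toL2 F K c₀ (Pi.single b Z))) bd‖
        ≤ C₁ * Real.exp (-(μ₁ * (Site.tdist (P := F.P K) (iterBlockOf (K - n) b.src) (iterBlockOf (K - n) bd.src) : ℝ))) * ‖Z‖)
    (h₂ : ∀ (b : PBond (F.P K) 0) (Z : Matrix (Fin 2) (Fin 2) ℂ) (bd : PBond (F.P K) 0),
      ‖(toL2 F K c₀).symm (B₂ (toL2 F K c₀ (Pi.single b Z))) bd‖
        ≤ C₂ * Real.exp (-(μ₂ * (Site.tdist (P := F.P K) (iterBlockOf (K - n) b.src) (iterBlockOf (K - n) bd.src) : ℝ))) * ‖Z‖)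
    (b : PBond (F.P K) 0) (Z : Matrix (Fin 2) (Fin 2) ℂ) (bd : PBond (F.P K) 0) :
    ‖(toL2 F K c₀).symm ((B₁ ∘ₗ B₂) (toL2 F K c₀ (Pi.single b Z))) bd‖
      ≤ C₁ * C₂ * (((F.P K).d : ℝ) * ((((F.P K).L : ℝ) ^ (F.P K).d) ^ (K - n))) * (2 * (1 + 1 / (μ₁ - r))) ^ 3
          * Real.exp (-(r * (Site.tdist (P := F.P K) (iterBlockOf (K - n) b.src) (iterBlockOf (K - n) bd.src) : ℝ))) * ‖Z‖ :=
  kernelRow_mul F B₁ B₂ hC₁ hC₂ hr hr₁ hr₂ h₁ h₂ b Z bd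

/-- ★★ **POWERS**: ROW(B; C, μ′), `0 ≤ r < μ′` ⇒ ROW(B^k; (C·V·S_{μ′−r})^k, r) for every `k` (through the gauge: ROW ⇒ COLW ⇒ COLW^k ⇒ ROW).
[cite: Balaban1984PropagatorsII, §2] -/
theorem kernelRow_pow (B : BondL2K ℂ 3 (periodsT3 F K) c₀ W₂ →ₗ[ℂ] BondL2K ℂ 3 (periodsT3 F K) c₀ W₂) {Ck μ' r : ℝ} (hCk : 0 ≤ Ck) (hr : 0 ≤ r) (hrμ : r < μ')
    (hk : ∀ (b : PBond (F.P K) 0) (Z : Matrix (Fin 2) (Fin 2) ℂ) (bd : PBond (F.P K) 0),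
      ‖(toL2 F K c₀).symm (B (toL2 F K c₀ (Pi.single b Z))) bd‖
        ≤ Ck * Real.exp (-(μ' * (Site.tdist (P := F.P K) (iterBlockOf (K - n) b.src) (iterBlockOf (K - n) bd.src) : ℝ))) * ‖Z‖)
    (k : ℕ) (b : PBond (F.P K) 0) (Z : Matrix (Fin 2) (Fin 2) ℂ) (bd : PBond (F.P K) 0) :
    ‖(toL2 F K c₀).symm ((B ^ k) (toL2 F K c₀ (Pi.single b Z))) bd‖
      ≤ (Ck * (((F.P K).d : ℝ) * ((((F.P K).L : ℝ) ^ (F.P K).d) ^ (K - n))) * (2 * (1 + 1 / (μ' - r))) ^ 3) ^ k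
          * Real.exp (-(r * (Site.tdist (P := F.P K) (iterBlockOf (K - n) b.src) (iterBlockOf (K - n) bd.src) : ℝ))) * ‖Z‖ := by
  have hν : 0 < μ' - r := by linarith
  exact kernelRow_of_colw F (B ^ k) (colw_pow F B hr (by positivity) (colw_of_kernelRow F B hCk hrμ hk) k) b Z bd

/-- Finite Neumann sums in ROW currency: ROW(B; C, μ′), `0 ≤ r < μ′`, `C·V·S_{μ′−r} < 1` ⇒ ROW(Σ_{k<m} B^k; 1∕(1 − C·V·S_{μ′−r}), r). [cite: Balaban1984PropagatorsII, §2] -/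
theorem kernelRow_geom_sum (B : BondL2K ℂ 3 (periodsT3 F K) c₀ W₂ →ₗ[ℂ] BondL2K ℂ 3 (periodsT3 F K) c₀ W₂) {Ck μ' r : ℝ} (hCk : 0 ≤ Ck) (hr : 0 ≤ r) (hrμ : r < μ')
    (hsmall : Ck * (((F.P K).d : ℝ) * ((((F.P K).L : ℝ) ^ (F.P K).d) ^ (K - n))) * (2 * (1 + 1 / (μ' - r))) ^ 3 < 1)
    (hk : ∀ (b : PBond (F.P K) 0) (Z : Matrix (Fin 2) (Fin 2) ℂ) (bd : PBond (F.P K) 0),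
      ‖(toL2 F K c₀).symm (B (toL2 F K c₀ (Pi.single b Z))) bd‖
        ≤ Ck * Real.exp (-(μ' * (Site.tdist (P := F.P K) (iterBlockOf (K - n) b.src) (iterBlockOf (K - n) bd.src) : ℝ))) * ‖Z‖)
    (m : ℕ) (b : PBond (F.P K) 0) (Z : Matrix (Fin 2) (Fin 2) ℂ) (bd : PBond (F.P K) 0) :
    ‖(toL2 F K c₀).symm ((∑ k ∈ Finset.range m, B ^ k) (toL2 F K c₀ (Pi.single b Z))) bd‖
      ≤ (1 / (1 - Ck * (((F.P K).d : ℝ) * ((((F.P K).L : ℝ) ^ (F.P K).d) ^ (K - n))) * (2 * (1 + 1 / (μ' - r))) ^ 3))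
          * Real.exp (-(r * (Site.tdist (P := F.P K) (iterBlockOf (K - n) b.src) (iterBlockOf (K - n) bd.src) : ℝ))) * ‖Z‖ := by
  have hν : 0 < μ' - r := by linarith
  exact kernelRow_of_colw F _ (colw_geom_sum F B hr (by positivity) hsmall (colw_of_kernelRow F B hCk hrμ hk) m) b Z bd

/-! ## §3 The Neumann inverse without a series -/

/-- ★★★ **THE INVERSE ROW FROM A LEFT-INVERSE IDENTITY**: COLW(B; N, r), `0 ≤ r`, `0 ≤ N < 1`, `(1 − B)·U = 1` ⇒ COLW(U; 1∕(1−N), r) — `U = 1 + B·U`, so the finite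
weighted sum obeys `S_U ≤ ‖Z‖ + N·S_U`. [cite: Balaban1985BackgroundPropagators, (3.86) p.409; Balaban1984PropagatorsII, §2] -/
theorem colw_of_mul_eq_one (B U : BondL2K ℂ 3 (periodsT3 F K) c₀ W₂ →ₗ[ℂ] BondL2K ℂ 3 (periodsT3 F K) c₀ W₂) {N r : ℝ} (hr : 0 ≤ r) (hN1 : N < 1)
    (hcol : ∀ (b : PBond (F.P K) 0) (Z : Matrix (Fin 2) (Fin 2) ℂ),
      ∑ bd : PBond (F.P K) 0, ‖(toL2 F K c₀).symm (B (toL2 F K c₀ (Pi.single b Z))) bd‖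
          * Real.exp (r * (Site.tdist (P := F.P K) (iterBlockOf (K - n) b.src) (iterBlockOf (K - n) bd.src) : ℝ)) ≤ N * ‖Z‖)
    (hU : (1 - B) * U = 1) (b : PBond (F.P K) 0) (Z : Matrix (Fin 2) (Fin 2) ℂ) :
    ∑ bd : PBond (F.P K) 0, ‖(toL2 F K c₀).symm (U (toL2 F K c₀ (Pi.single b Z))) bd‖
          * Real.exp (r * (Site.tdist (P := F.P K) (iterBlockOf (K - n) b.src) (iterBlockOf (K - n) bd.src) : ℝ)) ≤ (1 / (1 - N)) * ‖Z‖ := by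
  classical
  -- `U v = v + B (U v)`
  have hfix : U (toL2 F K c₀ (Pi.single b Z)) = toL2 F K c₀ (Pi.single b Z) + B (U (toL2 F K c₀ (Pi.single b Z))) := by
    have h := congrArg (fun T : BondL2K ℂ 3 (periodsT3 F K) c₀ W₂ →ₗ[ℂ] BondL2K ℂ 3 (periodsT3 F K) c₀ W₂ => T (toL2 F K c₀ (Pi.single b Z))) hU
    simp only [Module.End.mul_apply, LinearMap.sub_apply, Module.End.one_apply] at h
    exact sub_eq_iff_eq_add.mp h
  have hpt : ∀ bd : PBond (F.P K) 0, (toL2 F K c₀).symm (U (toL2 F K c₀ (Pi.single b Z))) bd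
      = (Pi.single b Z : PBond (F.P K) 0 → Matrix (Fin 2) (Fin 2) ℂ) bd
        + (toL2 F K c₀).symm (B (toL2 F K c₀ ((toL2 F K c₀).symm (U (toL2 F K c₀ (Pi.single b Z)))))) bd := by
    intro bd
    rw [LinearEquiv.apply_symm_apply]
    conv_lhs => rw [hfix]
    rw [map_add, LinearEquiv.symm_apply_apply, Pi.add_apply]
  set S := ∑ bd : PBond (F.P K) 0, ‖(toL2 F K c₀).symm (U (toL2 F K c₀ (Pi.single b Z))) bd‖ * Real.exp (r * (Site.tdist (P := F.P K) (iterBlockOf (K - n) b.src) (iterBlockOf (K - n) bd.src) : ℝ)) with hS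
  have hB := colw_apply_le F B hr hcol ((toL2 F K c₀).symm (U (toL2 F K c₀ (Pi.single b Z)))) b
  have hI := colw_one F (n := n) (c₀ := c₀) r b Z
  simp_rw [Module.End.one_apply, LinearEquiv.symm_apply_apply] at hI
  have hSle : S ≤ ‖Z‖ + N * S := by
    calc S = ∑ bd : PBond (F.P K) 0, ‖(Pi.single b Z : PBond (F.P K) 0 → Matrix (Fin 2) (Fin 2) ℂ) bd + (toL2 F K c₀).symm (B (toL2 F K c₀ ((toL2 F K c₀).symm (U (toL2 F K c₀ (Pi.single b Z)))))) bd‖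
            * Real.exp (r * (Site.tdist (P := F.P K) (iterBlockOf (K - n) b.src) (iterBlockOf (K - n) bd.src) : ℝ)) := Finset.sum_congr rfl fun bd _ => by rw [← hpt bd]
      _ ≤ ∑ bd : PBond (F.P K) 0, (‖(Pi.single b Z : PBond (F.P K) 0 → Matrix (Fin 2) (Fin 2) ℂ) bd‖ * Real.exp (r * (Site.tdist (P := F.P K) (iterBlockOf (K - n) b.src) (iterBlockOf (K - n) bd.src) : ℝ))
            + ‖(toL2 F K c₀).symm (B (toL2 F K c₀ ((toL2 F K c₀).symm (U (toL2 F K c₀ (Pi.single b Z)))))) bd‖ * Real.exp (r * (Site.tdist (P := F.P K) (iterBlockOf (K - n) b.src) (iterBlockOf (K - n) bd.src) : ℝ))) := by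
          refine Finset.sum_le_sum fun bd _ => ?_
          rw [← add_mul]
          exact mul_le_mul_of_nonneg_right (norm_add_le _ _) (Real.exp_pos _).le
      _ ≤ 1 * ‖Z‖ + N * S := by rw [Finset.sum_add_distrib]; exact add_le_add hI hB
      _ = ‖Z‖ + N * S := by ring
  have h1N : 0 < 1 - N := by linarith
  rw [div_mul_eq_mul_div, one_mul, le_div_iff₀ h1N]
  nlinarith

/-- **`1 − B` IS INJECTIVE** when COLW(B; N, r) with `0 ≤ r`, `N < 1`: `x = Bx` forces the weighted `ℓ¹` mass of `x` to vanish. [cite: Balaban1984PropagatorsII, §2] -/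
theorem injective_one_sub_of_colw (B : BondL2K ℂ 3 (periodsT3 F K) c₀ W₂ →ₗ[ℂ] BondL2K ℂ 3 (periodsT3 F K) c₀ W₂) {N r : ℝ} (hr : 0 ≤ r) (hN1 : N < 1)
    (hcol : ∀ (b : PBond (F.P K) 0) (Z : Matrix (Fin 2) (Fin 2) ℂ),
      ∑ bd : PBond (F.P K) 0, ‖(toL2 F K c₀).symm (B (toL2 F K c₀ (Pi.single b Z))) bd‖
          * Real.exp (r * (Site.tdist (P := F.P K) (iterBlockOf (K - n) b.src) (iterBlockOf (K - n) bd.src) : ℝ)) ≤ N * ‖Z‖) :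
    Function.Injective ((1 - B : BondL2K ℂ 3 (periodsT3 F K) c₀ W₂ →ₗ[ℂ] BondL2K ℂ 3 (periodsT3 F K) c₀ W₂)) := by
  classical
  rw [← LinearMap.ker_eq_bot, LinearMap.ker_eq_bot']
  intro v hv
  have hv' : B v = v := by
    have : v - B v = 0 := by simpa [LinearMap.sub_apply, Module.End.one_apply] using hv
    exact (sub_eq_zero.mp this).symm
  -- the bond function of `v`
  set X := (toL2 F K c₀).symm v with hX
  have hvX : v = toL2 F K c₀ X := by rw [hX, LinearEquiv.apply_symm_apply]
  suffices hX0 : X = 0 by rw [hvX, hX0, map_zero]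
  rcases isEmpty_or_nonempty (PBond (F.P K) 0) with hE | ⟨⟨b₀⟩⟩
  · exact funext fun b => (hE.false b).elim
  have hB := colw_apply_le F B hr hcol X b₀
  rw [← hvX, hv', ← hX] at hB
  -- `S ≤ N S` with `S ≥ 0`, `N < 1` ⇒ `S = 0`
  have hS0 : 0 ≤ ∑ b' : PBond (F.P K) 0, ‖X b'‖ * Real.exp (r * (Site.tdist (P := F.P K) (iterBlockOf (K - n) b₀.src) (iterBlockOf (K - n) b'.src) : ℝ)) :=
    Finset.sum_nonneg fun b' _ => by positivity
  have hS : ∑ b' : PBond (F.P K) 0, ‖X b'‖ * Real.exp (r * (Site.tdist (P := F.P K) (iterBlockOf (K - n) b₀.src) (iterBlockOf (K - n) b'.src) : ℝ)) = 0 := by nlinarith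
  rw [Finset.sum_eq_zero_iff_of_nonneg fun b' _ => by positivity] at hS
  funext b'
  have := hS b' (Finset.mem_univ _)
  rw [mul_eq_zero] at this
  rcases this with h | h
  · exact norm_eq_zero.mp h
  · exact absurd h (Real.exp_pos _).ne'

/-- ★ **`1 − B` IS INVERTIBLE** when COLW(B; N, r) with `0 ≤ r`, `N < 1`: a two-sided inverse exists (injective ⇒ bijective, `BondL2K` finite-dimensional through `toL2`).
[cite: Balaban1984PropagatorsII, §2] -/
theorem exists_inverse_one_sub_of_colw (B : BondL2K ℂ 3 (periodsT3 F K) c₀ W₂ →ₗ[ℂ] BondL2K ℂ 3 (periodsT3 F K) c₀ W₂) {N r : ℝ} (hr : 0 ≤ r) (hN1 : N < 1)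
    (hcol : ∀ (b : PBond (F.P K) 0) (Z : Matrix (Fin 2) (Fin 2) ℂ),
      ∑ bd : PBond (F.P K) 0, ‖(toL2 F K c₀).symm (B (toL2 F K c₀ (Pi.single b Z))) bd‖
          * Real.exp (r * (Site.tdist (P := F.P K) (iterBlockOf (K - n) b.src) (iterBlockOf (K - n) bd.src) : ℝ)) ≤ N * ‖Z‖) :
    ∃ U : BondL2K ℂ 3 (periodsT3 F K) c₀ W₂ →ₗ[ℂ] BondL2K ℂ 3 (periodsT3 F K) c₀ W₂, (1 - B) * U = 1 ∧ U * (1 - B) = 1 := by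
  haveI : FiniteDimensional ℂ (BondL2K ℂ 3 (periodsT3 F K) c₀ W₂) := LinearEquiv.finiteDimensional (toL2 F K c₀)
  have hinj := injective_one_sub_of_colw F B hr hN1 hcol
  have hbij : Function.Bijective ((1 - B : BondL2K ℂ 3 (periodsT3 F K) c₀ W₂ →ₗ[ℂ] BondL2K ℂ 3 (periodsT3 F K) c₀ W₂)) := ⟨hinj, LinearMap.surjective_of_injective hinj⟩
  let e : BondL2K ℂ 3 (periodsT3 F K) c₀ W₂ ≃ₗ[ℂ] BondL2K ℂ 3 (periodsT3 F K) c₀ W₂ := LinearEquiv.ofBijective (1 - B) hbij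
  refine ⟨(e.symm : BondL2K ℂ 3 (periodsT3 F K) c₀ W₂ →ₗ[ℂ] BondL2K ℂ 3 (periodsT3 F K) c₀ W₂), ?_, ?_⟩
  · ext v
    have : (1 - B) (e.symm v) = v := e.apply_symm_apply v
    simpa [Module.End.mul_apply] using this
  · ext v
    have : e.symm ((1 - B) v) = v := e.symm_apply_apply v
    simpa [Module.End.mul_apply] using this

/-- The inverse row from a RIGHT-inverse identity `U·(1 − B) = 1` (a right inverse is a left inverse on the finite-dimensional `BondL2K`). [cite: Balaban1984PropagatorsII, §2] -/
theorem colw_of_mul_eq_one' (B U : BondL2K ℂ 3 (periodsT3 F K) c₀ W₂ →ₗ[ℂ] BondL2K ℂ 3 (periodsT3 F K) c₀ W₂) {N r : ℝ} (hr : 0 ≤ r) (hN1 : N < 1)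
    (hcol : ∀ (b : PBond (F.P K) 0) (Z : Matrix (Fin 2) (Fin 2) ℂ),
      ∑ bd : PBond (F.P K) 0, ‖(toL2 F K c₀).symm (B (toL2 F K c₀ (Pi.single b Z))) bd‖
          * Real.exp (r * (Site.tdist (P := F.P K) (iterBlockOf (K - n) b.src) (iterBlockOf (K - n) bd.src) : ℝ)) ≤ N * ‖Z‖)
    (hU : U * (1 - B) = 1) (b : PBond (F.P K) 0) (Z : Matrix (Fin 2) (Fin 2) ℂ) :
    ∑ bd : PBond (F.P K) 0, ‖(toL2 F K c₀).symm (U (toL2 F K c₀ (Pi.single b Z))) bd‖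
          * Real.exp (r * (Site.tdist (P := F.P K) (iterBlockOf (K - n) b.src) (iterBlockOf (K - n) bd.src) : ℝ)) ≤ (1 / (1 - N)) * ‖Z‖ := by
  haveI : FiniteDimensional ℂ (BondL2K ℂ 3 (periodsT3 F K) c₀ W₂) := LinearEquiv.finiteDimensional (toL2 F K c₀)
  exact colw_of_mul_eq_one F B U hr hN1 hcol (mul_eq_one_comm.mp hU) b Z

/-- ★★★ **THE NEUMANN INVERSE IN ROW CURRENCY**: ROW(B; C, μ′), `0 ≤ C`, `0 ≤ r < μ′`, `C·V·S_{μ′−r} < 1` and ANY `U` with `(1 − B)·U = 1` ⇒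
ROW(U; 1∕(1 − C·V·S_{μ′−r}), r).  At the pins (`C = cℓ⁻³`, `V = 3ℓ³`) the smallness `3cS < 1` is K-free. [cite: Balaban1985BackgroundPropagators, (3.86) p.409, (3.131) p.421] -/
theorem kernelRow_inverse_of_kernelRow (B U : BondL2K ℂ 3 (periodsT3 F K) c₀ W₂ →ₗ[ℂ] BondL2K ℂ 3 (periodsT3 F K) c₀ W₂) {Ck μ' r : ℝ} (hCk : 0 ≤ Ck) (hr : 0 ≤ r) (hrμ : r < μ')
    (hsmall : Ck * (((F.P K).d : ℝ) * ((((F.P K).L : ℝ) ^ (F.P K).d) ^ (K - n))) * (2 * (1 + 1 / (μ' - r))) ^ 3 < 1)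
    (hk : ∀ (b : PBond (F.P K) 0) (Z : Matrix (Fin 2) (Fin 2) ℂ) (bd : PBond (F.P K) 0),
      ‖(toL2 F K c₀).symm (B (toL2 F K c₀ (Pi.single b Z))) bd‖
        ≤ Ck * Real.exp (-(μ' * (Site.tdist (P := F.P K) (iterBlockOf (K - n) b.src) (iterBlockOf (K - n) bd.src) : ℝ))) * ‖Z‖)
    (hU : (1 - B) * U = 1) (b : PBond (F.P K) 0) (Z : Matrix (Fin 2) (Fin 2) ℂ) (bd : PBond (F.P K) 0) :
    ‖(toL2 F K c₀).symm (U (toL2 F K c₀ (Pi.single b Z))) bd‖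
      ≤ (1 / (1 - Ck * (((F.P K).d : ℝ) * ((((F.P K).L : ℝ) ^ (F.P K).d) ^ (K - n))) * (2 * (1 + 1 / (μ' - r))) ^ 3))
          * Real.exp (-(r * (Site.tdist (P := F.P K) (iterBlockOf (K - n) b.src) (iterBlockOf (K - n) bd.src) : ℝ))) * ‖Z‖ :=
  kernelRow_of_colw F U (colw_of_mul_eq_one F B U hr hsmall (colw_of_kernelRow F B hCk hrμ hk) hU) b Z bd

/-- ★ **EXISTENCE + ROW OF THE INVERSE**: ROW(B; C, μ′), `0 ≤ C`, `0 ≤ r < μ′`, `C·V·S_{μ′−r} < 1` ⇒ `1 − B` has a two-sided inverse `U` with ROW(U; 1∕(1 − C·V·S_{μ′−r}), r).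
[cite: Balaban1985BackgroundPropagators, (3.86) p.409, (3.131) p.421; Balaban1984PropagatorsII, §2] -/
theorem exists_inverse_kernelRow (B : BondL2K ℂ 3 (periodsT3 F K) c₀ W₂ →ₗ[ℂ] BondL2K ℂ 3 (periodsT3 F K) c₀ W₂) {Ck μ' r : ℝ} (hCk : 0 ≤ Ck) (hr : 0 ≤ r) (hrμ : r < μ')
    (hsmall : Ck * (((F.P K).d : ℝ) * ((((F.P K).L : ℝ) ^ (F.P K).d) ^ (K - n))) * (2 * (1 + 1 / (μ' - r))) ^ 3 < 1)
    (hk : ∀ (b : PBond (F.P K) 0) (Z : Matrix (Fin 2) (Fin 2) ℂ) (bd : PBond (F.P K) 0),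
      ‖(toL2 F K c₀).symm (B (toL2 F K c₀ (Pi.single b Z))) bd‖
        ≤ Ck * Real.exp (-(μ' * (Site.tdist (P := F.P K) (iterBlockOf (K - n) b.src) (iterBlockOf (K - n) bd.src) : ℝ))) * ‖Z‖) :
    ∃ U : BondL2K ℂ 3 (periodsT3 F K) c₀ W₂ →ₗ[ℂ] BondL2K ℂ 3 (periodsT3 F K) c₀ W₂, (1 - B) * U = 1 ∧ U * (1 - B) = 1 ∧
      ∀ (b : PBond (F.P K) 0) (Z : Matrix (Fin 2) (Fin 2) ℂ) (bd : PBond (F.P K) 0),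
        ‖(toL2 F K c₀).symm (U (toL2 F K c₀ (Pi.single b Z))) bd‖
          ≤ (1 / (1 - Ck * (((F.P K).d : ℝ) * ((((F.P K).L : ℝ) ^ (F.P K).d) ^ (K - n))) * (2 * (1 + 1 / (μ' - r))) ^ 3))
              * Real.exp (-(r * (Site.tdist (P := F.P K) (iterBlockOf (K - n) b.src) (iterBlockOf (K - n) bd.src) : ℝ))) * ‖Z‖ := by
  obtain ⟨U, hU, hU'⟩ := exists_inverse_one_sub_of_colw F B hr hsmall (colw_of_kernelRow F B hCk hrμ hk)
  exact ⟨U, hU, hU', kernelRow_inverse_of_kernelRow F B U hCk hr hrμ hsmall hk hU⟩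

end Summit.QuantumFields.YangMills.Theorems.Prop7KernelRowComposition

end
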